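import Summits.QuantumFields.BalabanUV.T4Continuum.Spine.NE1p.DressedSmallFieldTBoxMixedLetterSourceSeries
import Summits.QuantumFields.BalabanUV.T4Continuum.Spine.NE1p.DressedSmallFieldTBoxMixedLetterSourceInsertion

/-!
# T⁴ programme, spine estimate NE1′ (node O3b/H2) — THE AFFINELY COUPLED LETTER IS ENTIRE OF EXPONENTIAL TYPE IN THE SOURCE: for
# `E(μ; v) = G(v)·e^{Φ₀(v) + μ·O(v)}` the (1.23)∕(2.14) letter is defined at EVERY complex source, bounded by `ρ⁻¹·A₀·e^{R₁|μ|}·e^{−(κ₁−1)·#S}`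
# (`A₀ ≥ |G·e^{Φ₀}|`, `R₁ ≥ |O|` on the contour set), all its source derivatives by `ρ⁻¹·R₁^k·A₀·e^{R₁|μ|}·e^{…}`, and it IS the exponential
# generating series of the insertion letters: `(1.23)(E(μ)) = Σ_k μ^k∕k! · (1.23)(O^k·G·e^{Φ₀})` for ALL `μ ∈ ℂ` — no window, no third radius, growth
# rate = the insertion's size

Cell `pub-balaban`, sub-cell `t4`, row NE1′ formalisation crew (`t4/formal/NE1p/LEAVES.md` row W⟨next⟩ — own-initiative DICTIONARY capstone of the
unit's source-calculus rows W103 «SourceCommute» (p245083), W106 «SourceSeries» (p245467) and «SourceInsertion», under typer R-T61 (ii)), unit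
`b2b-balaban-t4-ne1p-formalise-leaf-08` (gen 14).  ADDITIVE — imports W106 `Spine/NE1p/DressedSmallFieldTBoxMixedLetterSourceSeries`
(`hasSum_tBoxMixedLetter_source`) + «SourceInsertion» `Spine/NE1p/DressedSmallFieldTBoxMixedLetterSourceInsertion` (`iteratedDeriv_mul_cexp_affine`,
`analyticOnNhd_mul_cexp`, `norm_iteratedDeriv_tBoxMixedLetter_affine_source_le`, `analyticOnNhd_tzz`) ONLY (→ W103, W93 `analyticOnNhd_section`, W89
`norm_tBoxMixedLetter_le`∕`tBoxMixedLetter_eq_mixedDiff_deriv_local`, W39.1 `mixedDiff_pair`, the substrate's `w₁`∕`circ`, the template's `polydisc` — BY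
NAME) + Mathlib (`Complex.norm_exp_le_exp_norm`, `NormedSpace.expSeries_div_hasSum_exp`, `Real.exp_eq_exp_ℝ`).  THEOREMS ONLY + `example`s; 0 `def`,
0 `instance`, 0 `def … : Prop`, 0 cite, 0 sorry, 0 `attribute`; nothing upstream restated.

WHY THIS FILE.  W106 expanded the letter in the source INSIDE the disc of analyticity with Cauchy-priced coefficients (`k!·B∕μ₁′^k`), and
«SourceInsertion» showed that for an exponentially coupled factor the source derivatives are insertions priced by powers of the insertion's
size.  Put together for the AFFINE coupling `Φ = Φ₀ + μ·O` — the form in which a source term `μ·O` ADDED TO THE ACTION enters a (2.14)-type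
exponential `exp[Σ τ(Y)V_k(Y,B)]` ([Balaban1988RGII] p. 15 (2.14), p. 16 (2.20) — LOCI of the audited manuscript, TYPE∕CONTEXT; print has no
source, the μ-extension is the cell's, note (n1)) — the (w6)-window disappears altogether at the letter object:
* §1 [folklore] **`norm_mul_cexp_affine_le`**: `‖G·e^{Φ₀ + μO}‖ ≤ ‖G·e^{Φ₀}‖·e^{|μ|·‖O‖}` (Mathlib `Complex.norm_exp_le_exp_norm`);
* §2 **`norm_tBoxMixedLetter_affine_le`**: for `G`, `Φ₀`, `O` analytic on `Π_j{|v_j| < R_j}`, `κ₁ ≥ 1`, `R_{j+1} > e^{κ₁}`, `0 < ρ < R₀`, `1 < r_j < R_{j+1}`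
  and bounds `‖O(t ∷ z)‖ ≤ R₁`, `‖G(t ∷ z)·e^{Φ₀(t ∷ z)}‖ ≤ A₀` on `{|t| = ρ} × {|z_j| ≤ e^{κ₁}}`: at EVERY `μ ∈ ℂ`,
  `‖(1.23)(E(μ))‖ ≤ ρ⁻¹·(A₀·e^{R₁|μ|})·e^{−(κ₁−1)·#S}` — (1.24)'s shape with the (1.21)-type sup supplied at every source by §1 (W89's END on the
  section); **`norm_iteratedDeriv_tBoxMixedLetter_affine_le`**: `‖∂^k_μ (1.23)(E(·))(μ)‖ ≤ ρ⁻¹·(R₁^k·A₀·e^{R₁|μ|})·e^{−(κ₁−1)·#S}` at every `μ`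
  («SourceInsertion» §4 with `A := A₀·e^{R₁|μ|}`);
* §3 **`hasSum_tBoxMixedLetter_affine`**: for EVERY `μ ∈ ℂ`, `(1.23)(E(μ)) = Σ_k (k!)⁻¹·μ^k·(1.23)(O^k·G·e^{Φ₀})` (`HasSum`) — W106's Taylor series on
  the disc of radius `|μ| + 1` (the datum is entire in the source) with its coefficients identified by «SourceInsertion»'s
  `iteratedDeriv_mul_cexp_affine` at `μ = 0`: THE LETTER OF AN AFFINELY COUPLED FACTOR IS THE EXPONENTIAL GENERATING SERIES OF ITS INSERTION
  LETTERS; **`norm_insertionCoeff_le`**: the `k`-th term costs `ρ⁻¹·A₀·e^{−(κ₁−1)·#S}·(R₁|μ|)^k∕k!`, whose sum over `k` is §2's `e^{R₁|μ|}`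
  (`hasSum_majorant` — Mathlib's exponential series);
* §4 decided (`E = e^{μ·t·z₀z₁}`, `t_□`-radius `1`, cube radii `3∕2`): the letter IS `μ` at every source — entire, of exponential type `0 ≤ R₁` — and
  §2's bound reads `|μ| ≤ e^{e²|μ|}` at `κ₁ = 1` (`R₁ = e²` bounds `|t z₀z₁|` on `{|t| = 1} × {|z_j| ≤ e}`, `A₀ = 1`).

HONEST FRAMING.  [folklore] elementary estimates (`|e^w| ≤ e^{|w|}`, the exponential series) + W106∕«SourceInsertion»∕W103∕W89 BY NAME on OUR
dictionary objects; a DICTIONARY row — the SHAPE of the source dependence of an affinely coupled (1.23)∕(2.14)-type letter (entire, exponential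
type = insertion size), NOT an estimate of print and NOT a statement about Bałaban's densities: that the cell's dressed small-field factor is
affinely coupled in μ with (2.20)-type bounds `R₁`, `A₀` is a TYPE READING of (2.14)'s exponential under the cell's μ-extension (notes (n1)∕(n2),
CELL records) — for Bałaban's dressed input such data are (w1)∕(B2)-type birth data, NEW-UNPRINTED, HYPOTHESES here; the row does NOT assert that
the cell's activities stay affinely coupled under renormalisation (then W106's windowed form or «SourceInsertion» §3's first-order form is the
statement); it RELOCATES the question «window or no window» to the FORM of the coupling and discharges nothing; `G`∕`Φ₀`∕`O`∕`R₁`∕`A₀`∕radii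
HYPOTHESES∕symbols; (2.20), Lemma 3, `C₃`, (1.25) NOT touched; no numeral of [Balaban1988RGII] asserted (k2); (w5)∕(w5b)∕(w6) NOT discharged; (B1) for
Bałaban's (2.14) NOT discharged; (B3) = GAPS G-ne9p2-5 UNPRINTED — NOT discharged, untouched; (B5) untouched; 0 binders instantiated on Bałaban's
densities ∕ operators ∕ (2.14) data ∕ `d_k` ∕ minimisers ∕ backgrounds; discharges no wall item; wall v1.8 (T4-DAG v48) does NOT move; R-t4r2-Q2 NOT
met thereby; NE1′ ⇐ the named binders — NOT proved, NOT printed; spine PROVED 0∕9; count 9 unchanged.  Rung (B)+1 on ONE finite four-torus — NOT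
infinite volume, NOT a mass gap, NOT OS on ℝ⁴, NOT Clay.  ABSOLUTE RULE honoured: the quotations are LOCI of the audited manuscript
[Balaban1988RGII] (CMP 116 (1988) 1–22, pp. 15–16), TYPE∕CONTEXT only; the referee notes are CELL records quoted as such; nothing internally
minted is cited as a fact; [folklore] tags on kernel lemmas only.  HONEST DEPENDENCY: continuum YM on T⁴ ⇐ BetaPertH ∧ nine spine estimates (0/9
proved); BetaPertH ⇐ (D1) ∧ (D4) ∧ CAP+tail; G-an2-4 gates asym, D1 and NE2/3/4.
-/

noncomputable section

namespace Summit.QuantumFields.BalabanUV.T4Continuum.NE1p.DressedSmallFieldTBoxMixedLetterSourceEntire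

open MeasureTheory Metric Set Complex Finset Function Filter
open scoped BigOperators Topology Nat
open Summit.QuantumFields.BalabanUV.T4Continuum.B13TermContours
open Summit.QuantumFields.BalabanUV.T4Continuum.NE1p.DressedSmallFieldMixedLetter
open Summit.QuantumFields.BalabanUV.T4Continuum.NE1p.DressedSmallFieldTBoxMixedLetterLocal (norm_tBoxMixedLetter_le tBoxMixedLetter_eq_mixedDiff_deriv_local)
open Summit.QuantumFields.BalabanUV.T4Continuum.NE1p.DressedSmallFieldTBoxMixedLetterSpectator (analyticOnNhd_section)
open Summit.QuantumFields.BalabanUV.T4Continuum.NE1p.DressedSmallFieldTBoxMixedLetterSourceCommute (cons_mem_polyBall)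
open Summit.QuantumFields.BalabanUV.T4Continuum.NE1p.DressedSmallFieldTBoxMixedLetterSourceSeries (hasSum_tBoxMixedLetter_source)
open Summit.QuantumFields.BalabanUV.T4Continuum.NE1p.DressedSmallFieldTBoxMixedLetterSourceInsertion
open Literature.MathematicalPhysics.QuantumFieldTheory.Dimock2011to13.PolydiscCauchyBounds (polydisc)

variable {n : ℕ}

/-! ## §1 [folklore] The affinely coupled factor grows at most exponentially in the source -/

/-- **`‖G·e^{Φ₀ + μ·O}‖ ≤ ‖G·e^{Φ₀}‖ · e^{|μ|·‖O‖}`** [folklore] (`e^{Φ₀ + μO} = e^{Φ₀}·e^{μO}` and Mathlib `Complex.norm_exp_le_exp_norm`). -/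
theorem norm_mul_cexp_affine_le (G Φ₀ O μ : ℂ) : ‖G * cexp (Φ₀ + μ * O)‖ ≤ ‖G * cexp Φ₀‖ * Real.exp (‖μ‖ * ‖O‖) := by
  rw [Complex.exp_add, ← mul_assoc, norm_mul (G * cexp Φ₀)]
  refine mul_le_mul_of_nonneg_left ?_ (norm_nonneg _)
  calc ‖cexp (μ * O)‖ ≤ Real.exp ‖μ * O‖ := Complex.norm_exp_le_exp_norm _
    _ = Real.exp (‖μ‖ * ‖O‖) := by rw [norm_mul]

/-- [folklore] … hence, under `‖O‖ ≤ R₁` and `‖G·e^{Φ₀}‖ ≤ A₀`: `‖G·e^{Φ₀ + μ·O}‖ ≤ A₀·e^{R₁·|μ|}`. -/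
theorem norm_mul_cexp_affine_le_of_bounds {G Φ₀ O : ℂ} {R₁ A₀ : ℝ} (hO : ‖O‖ ≤ R₁) (hA : ‖G * cexp Φ₀‖ ≤ A₀) (μ : ℂ) :
    ‖G * cexp (Φ₀ + μ * O)‖ ≤ A₀ * Real.exp (R₁ * ‖μ‖) := by
  have hA0 : 0 ≤ A₀ := le_trans (norm_nonneg _) hA
  calc ‖G * cexp (Φ₀ + μ * O)‖ ≤ ‖G * cexp Φ₀‖ * Real.exp (‖μ‖ * ‖O‖) := norm_mul_cexp_affine_le G Φ₀ O μ
    _ ≤ A₀ * Real.exp (R₁ * ‖μ‖) := by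
        refine mul_le_mul hA (Real.exp_le_exp.2 ?_) (Real.exp_pos _).le hA0
        rw [mul_comm]
        exact mul_le_mul_of_nonneg_right hO (norm_nonneg _)

/-! ## §2 THE LETTER AND ALL ITS SOURCE DERIVATIVES AT EVERY COMPLEX SOURCE — no window -/

/-- **THE AFFINELY COUPLED LETTER IS BOUNDED AT EVERY SOURCE BY `ρ⁻¹·A₀·e^{R₁|μ|}·e^{−(κ₁−1)·#S}`** (kernel; W89 `norm_tBoxMixedLetter_le` on the section
`E(μ; ·)` — analytic by «SourceInsertion» `analyticOnNhd_mul_cexp` on `univ × polydisc` — with the (1.21)-type sup `A := A₀·e^{R₁|μ|}` SUPPLIED by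
§1 at every contour point): for `G`, `Φ₀`, `O` analytic on `Π_j{|v_j| < R_j}`, `κ₁ ≥ 1`, `R_{j+1} > e^{κ₁}`, the `t_□`-radius `0 < ρ < R₀`, contour radii
`1 < r_j < R_{j+1}`, bounds `‖O(t ∷ z)‖ ≤ R₁` and `‖G(t ∷ z)·e^{Φ₀(t ∷ z)}‖ ≤ A₀` on `{|t| = ρ} × {|z_j| ≤ e^{κ₁}}` (HYPOTHESES of (2.20)∕(1.21) TYPE),
and EVERY `μ ∈ ℂ`:
`‖∫_{θ_□} w₁ ρ (0,θ_□)·(∫ wS r S p·G·e^{Φ₀ + μO}(circ ρ θ_□ ∷ σ_S p) d(⨂ μS S)) dθ_□‖ ≤ ρ⁻¹·(A₀·e^{R₁·|μ|}·e^{−(κ₁−1)·#S})` — the source dependence of an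
affinely coupled (1.23)∕(2.14)-type letter is ENTIRE OF EXPONENTIAL TYPE `R₁` (the insertion's size): NO disc of analyticity, NO window, NO third
radius (contrast W98∕W106's generic windowed forms). [folklore] -/
theorem norm_tBoxMixedLetter_affine_le {ρ : ℝ} (hρ : 0 < ρ) {r : Fin n → ℝ} {R : Fin (n + 1) → ℝ} (hρR : ρ < R 0) (hr : ∀ j, 1 < r j)
    (hrR : ∀ j : Fin n, r j < R j.succ) {κ₁ R₁ A₀ : ℝ} (hκ : 1 ≤ κ₁) (hRκ : ∀ j : Fin n, Real.exp κ₁ < R j.succ) (S : Finset (Fin n))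
    {G Φ₀ O : (Fin (n + 1) → ℂ) → ℂ} (hG : AnalyticOnNhd ℂ G (Set.univ.pi fun j => ball (0 : ℂ) (R j)))
    (hΦ₀ : AnalyticOnNhd ℂ Φ₀ (Set.univ.pi fun j => ball (0 : ℂ) (R j))) (hO : AnalyticOnNhd ℂ O (Set.univ.pi fun j => ball (0 : ℂ) (R j)))
    (hR₁ : ∀ t : ℂ, ‖t‖ = ρ → ∀ z ∈ polydisc (fun _ : Fin n => Real.exp κ₁), ‖O (Fin.cons t z)‖ ≤ R₁)
    (hA₀ : ∀ t : ℂ, ‖t‖ = ρ → ∀ z ∈ polydisc (fun _ : Fin n => Real.exp κ₁), ‖G (Fin.cons t z) * cexp (Φ₀ (Fin.cons t z))‖ ≤ A₀) (μ : ℂ) :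
    ‖∫ θ₀ in Icc 0 (2 * Real.pi), w₁ ρ (0, θ₀) *
        ∫ p, wS r S p * (G (Fin.cons (circ ρ θ₀) (σS r S p)) *
          cexp (Φ₀ (Fin.cons (circ ρ θ₀) (σS r S p)) + μ * O (Fin.cons (circ ρ θ₀) (σS r S p)))) ∂(Measure.pi (μS S))‖ ≤
      ρ⁻¹ * (A₀ * Real.exp (R₁ * ‖μ‖) * Real.exp (-((κ₁ - 1) * S.card))) := by
  have hΦ : AnalyticOnNhd ℂ (fun q : ℂ × (Fin (n + 1) → ℂ) => Φ₀ q.2 + q.1 * O q.2) (univ ×ˢ Set.univ.pi fun j => ball (0 : ℂ) (R j)) :=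
    (hΦ₀.comp analyticOnNhd_snd fun _ hq => hq.2).add (analyticOnNhd_fst.mul (hO.comp analyticOnNhd_snd fun _ hq => hq.2))
  exact norm_tBoxMixedLetter_le hρ hρR hr hrR hκ hRκ S
    (analyticOnNhd_section (E := fun μ' v => G v * cexp (Φ₀ v + μ' * O v))
      (analyticOnNhd_mul_cexp (Φ := fun μ' v => Φ₀ v + μ' * O v) hG hΦ) (mem_univ μ))
    fun t ht z hz => norm_mul_cexp_affine_le_of_bounds (hR₁ t ht z hz) (hA₀ t ht z hz) μ

/-- **… AND SO IS EVERY SOURCE DERIVATIVE: `‖∂^k_μ (1.23)(E(·))(μ)‖ ≤ ρ⁻¹·(R₁^k·A₀·e^{R₁|μ|})·e^{−(κ₁−1)·#S}` AT EVERY `μ ∈ ℂ`** («SourceInsertion» §4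
`norm_iteratedDeriv_tBoxMixedLetter_affine_source_le` on `W = univ` with `A := A₀·e^{R₁|μ|}` from §1). [folklore] -/
theorem norm_iteratedDeriv_tBoxMixedLetter_affine_le {ρ : ℝ} (hρ : 0 < ρ) {r : Fin n → ℝ} {R : Fin (n + 1) → ℝ} (hρR : ρ < R 0)
    (hr : ∀ j, 1 < r j) (hrR : ∀ j : Fin n, r j < R j.succ) {κ₁ R₁ A₀ : ℝ} (hκ : 1 ≤ κ₁) (hRκ : ∀ j : Fin n, Real.exp κ₁ < R j.succ)
    (S : Finset (Fin n)) {G Φ₀ O : (Fin (n + 1) → ℂ) → ℂ} (hG : AnalyticOnNhd ℂ G (Set.univ.pi fun j => ball (0 : ℂ) (R j)))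
    (hΦ₀ : AnalyticOnNhd ℂ Φ₀ (Set.univ.pi fun j => ball (0 : ℂ) (R j))) (hO : AnalyticOnNhd ℂ O (Set.univ.pi fun j => ball (0 : ℂ) (R j)))
    (hR₁ : ∀ t : ℂ, ‖t‖ = ρ → ∀ z ∈ polydisc (fun _ : Fin n => Real.exp κ₁), ‖O (Fin.cons t z)‖ ≤ R₁)
    (hA₀ : ∀ t : ℂ, ‖t‖ = ρ → ∀ z ∈ polydisc (fun _ : Fin n => Real.exp κ₁), ‖G (Fin.cons t z) * cexp (Φ₀ (Fin.cons t z))‖ ≤ A₀)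
    (k : ℕ) (μ : ℂ) :
    ‖iteratedDeriv k (fun μ' : ℂ => ∫ θ₀ in Icc 0 (2 * Real.pi), w₁ ρ (0, θ₀) *
        ∫ p, wS r S p * (G (Fin.cons (circ ρ θ₀) (σS r S p)) *
          cexp (Φ₀ (Fin.cons (circ ρ θ₀) (σS r S p)) + μ' * O (Fin.cons (circ ρ θ₀) (σS r S p)))) ∂(Measure.pi (μS S))) μ‖ ≤
      ρ⁻¹ * (R₁ ^ k * (A₀ * Real.exp (R₁ * ‖μ‖)) * Real.exp (-((κ₁ - 1) * S.card))) :=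
  norm_iteratedDeriv_tBoxMixedLetter_affine_source_le isOpen_univ hρ hρR hr hrR hκ hRκ S hG hΦ₀ hO k (mem_univ μ) hR₁
    fun t ht z hz => norm_mul_cexp_affine_le_of_bounds (hR₁ t ht z hz) (hA₀ t ht z hz) μ

/-! ## §3 THE LETTER IS THE EXPONENTIAL GENERATING SERIES OF ITS INSERTION LETTERS — at every source -/

/-- **`(1.23)(G·e^{Φ₀ + μO}) = Σ_k (k!)⁻¹·μ^k·(1.23)(O^k·G·e^{Φ₀})` FOR EVERY `μ ∈ ℂ`** (kernel; W106 `hasSum_tBoxMixedLetter_source` on the source disc of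
radius `|μ| + 1` — the datum is jointly analytic on `ball 0 (|μ|+1) × polydisc` by «SourceInsertion» `analyticOnNhd_mul_cexp` — and its
coefficients `(1.23)(∂^k_μ E(0))` identified with the insertion letters by `iteratedDeriv_mul_cexp_affine` at `μ = 0`): for `G`, `Φ₀`, `O` analytic on
`Π_j{|v_j| < R_j}`, `0 < ρ < R₀`, `1 < r_j < R_{j+1}`, the letter of the affinely coupled factor is the exponential generating series of the letters
with `O^k` inserted — the source expansion «term by term with the observable insertion» has NO radius restriction at the letter object (a
reading of the cell's (n1)∕(n2) at this datum; nothing of print). [folklore] -/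
theorem hasSum_tBoxMixedLetter_affine {ρ : ℝ} (hρ : 0 < ρ) {r : Fin n → ℝ} {R : Fin (n + 1) → ℝ} (hρR : ρ < R 0) (hr : ∀ j, 1 < r j)
    (hrR : ∀ j : Fin n, r j < R j.succ) (S : Finset (Fin n)) {G Φ₀ O : (Fin (n + 1) → ℂ) → ℂ}
    (hG : AnalyticOnNhd ℂ G (Set.univ.pi fun j => ball (0 : ℂ) (R j))) (hΦ₀ : AnalyticOnNhd ℂ Φ₀ (Set.univ.pi fun j => ball (0 : ℂ) (R j)))
    (hO : AnalyticOnNhd ℂ O (Set.univ.pi fun j => ball (0 : ℂ) (R j))) (μ : ℂ) :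
    HasSum (fun k : ℕ => ((k.factorial : ℕ) : ℂ)⁻¹ • μ ^ k • ∫ θ₀ in Icc 0 (2 * Real.pi), w₁ ρ (0, θ₀) *
        ∫ p, wS r S p * (O (Fin.cons (circ ρ θ₀) (σS r S p)) ^ k * (G (Fin.cons (circ ρ θ₀) (σS r S p)) *
          cexp (Φ₀ (Fin.cons (circ ρ θ₀) (σS r S p))))) ∂(Measure.pi (μS S)))
      (∫ θ₀ in Icc 0 (2 * Real.pi), w₁ ρ (0, θ₀) *
        ∫ p, wS r S p * (G (Fin.cons (circ ρ θ₀) (σS r S p)) *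
          cexp (Φ₀ (Fin.cons (circ ρ θ₀) (σS r S p)) + μ * O (Fin.cons (circ ρ θ₀) (σS r S p)))) ∂(Measure.pi (μS S))) := by
  have hΦ : AnalyticOnNhd ℂ (fun q : ℂ × (Fin (n + 1) → ℂ) => Φ₀ q.2 + q.1 * O q.2)
      (ball (0 : ℂ) (‖μ‖ + 1) ×ˢ Set.univ.pi fun j => ball (0 : ℂ) (R j)) :=
    (hΦ₀.comp analyticOnNhd_snd fun _ hq => hq.2).add (analyticOnNhd_fst.mul (hO.comp analyticOnNhd_snd fun _ hq => hq.2))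
  have h := hasSum_tBoxMixedLetter_source hρ hρR hr hrR S (E := fun μ' v => G v * cexp (Φ₀ v + μ' * O v))
    (analyticOnNhd_mul_cexp (Φ := fun μ' v => Φ₀ v + μ' * O v) hG hΦ) (μ := μ) (by linarith [norm_nonneg μ])
  simp_rw [iteratedDeriv_mul_cexp_affine, zero_mul, add_zero] at h
  exact h

/-- **THE `k`-TH INSERTION TERM COSTS `ρ⁻¹·A₀·e^{−(κ₁−1)·#S} · (R₁|μ|)^k∕k!`** [folklore] (§2's derivative bound at `μ = 0`, where `e^{R₁·0} = 1`, read
through «SourceInsertion»'s affine identity: `‖(1.23)(O^k·G·e^{Φ₀})‖ ≤ ρ⁻¹·R₁^k·A₀·e^{…}`; then `‖(k!)⁻¹·μ^k·c‖ = |μ|^k·‖c‖∕k!`). -/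
theorem norm_insertionCoeff_le {ρ : ℝ} (hρ : 0 < ρ) {r : Fin n → ℝ} {R : Fin (n + 1) → ℝ} (hρR : ρ < R 0) (hr : ∀ j, 1 < r j)
    (hrR : ∀ j : Fin n, r j < R j.succ) {κ₁ R₁ A₀ : ℝ} (hκ : 1 ≤ κ₁) (hRκ : ∀ j : Fin n, Real.exp κ₁ < R j.succ) (S : Finset (Fin n))
    {G Φ₀ O : (Fin (n + 1) → ℂ) → ℂ} (hG : AnalyticOnNhd ℂ G (Set.univ.pi fun j => ball (0 : ℂ) (R j)))
    (hΦ₀ : AnalyticOnNhd ℂ Φ₀ (Set.univ.pi fun j => ball (0 : ℂ) (R j))) (hO : AnalyticOnNhd ℂ O (Set.univ.pi fun j => ball (0 : ℂ) (R j)))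
    (hR₁ : ∀ t : ℂ, ‖t‖ = ρ → ∀ z ∈ polydisc (fun _ : Fin n => Real.exp κ₁), ‖O (Fin.cons t z)‖ ≤ R₁)
    (hA₀ : ∀ t : ℂ, ‖t‖ = ρ → ∀ z ∈ polydisc (fun _ : Fin n => Real.exp κ₁), ‖G (Fin.cons t z) * cexp (Φ₀ (Fin.cons t z))‖ ≤ A₀)
    (k : ℕ) (μ : ℂ) :
    ‖((k.factorial : ℕ) : ℂ)⁻¹ • μ ^ k • ∫ θ₀ in Icc 0 (2 * Real.pi), w₁ ρ (0, θ₀) *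
        ∫ p, wS r S p * (O (Fin.cons (circ ρ θ₀) (σS r S p)) ^ k * (G (Fin.cons (circ ρ θ₀) (σS r S p)) *
          cexp (Φ₀ (Fin.cons (circ ρ θ₀) (σS r S p))))) ∂(Measure.pi (μS S))‖ ≤
      ρ⁻¹ * (A₀ * Real.exp (-((κ₁ - 1) * S.card))) * ((R₁ * ‖μ‖) ^ k / k.factorial) := by
  -- the insertion letter is the `k`-th source derivative of the letter at `μ = 0`
  have hc := norm_iteratedDeriv_tBoxMixedLetter_affine_le hρ hρR hr hrR hκ hRκ S hG hΦ₀ hO hR₁ hA₀ k 0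
  rw [iteratedDeriv_tBoxMixedLetter_affine_source isOpen_univ hρ hρR hr hrR S hG hΦ₀ hO k (mem_univ (0 : ℂ))] at hc
  simp only [norm_zero, mul_zero, Real.exp_zero, mul_one, zero_mul, add_zero] at hc
  have hfac : (0 : ℝ) < k.factorial := by exact_mod_cast k.factorial_pos
  have hR1 : 0 ≤ R₁ := le_trans (norm_nonneg _) (hR₁ (circ ρ 0) (norm_circ hρ.le 0) 0 fun _ => by simpa using (Real.exp_pos κ₁).le)
  rw [norm_smul, norm_smul, norm_inv, Complex.norm_natCast, norm_pow]
  calc (k.factorial : ℝ)⁻¹ * (‖μ‖ ^ k * ‖∫ θ₀ in Icc 0 (2 * Real.pi), w₁ ρ (0, θ₀) *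
        ∫ p, wS r S p * (O (Fin.cons (circ ρ θ₀) (σS r S p)) ^ k * (G (Fin.cons (circ ρ θ₀) (σS r S p)) *
          cexp (Φ₀ (Fin.cons (circ ρ θ₀) (σS r S p))))) ∂(Measure.pi (μS S))‖)
      ≤ (k.factorial : ℝ)⁻¹ * (‖μ‖ ^ k * (ρ⁻¹ * (R₁ ^ k * A₀ * Real.exp (-((κ₁ - 1) * S.card))))) := by gcongr
    _ = ρ⁻¹ * (A₀ * Real.exp (-((κ₁ - 1) * S.card))) * ((R₁ * ‖μ‖) ^ k / k.factorial) := by rw [mul_pow]; field_simp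

/-- **THE MAJORANT SUMS TO §2's BOUND** [folklore]: `Σ_k ρ⁻¹·A₀·e^{−(κ₁−1)·#S}·(R₁|μ|)^k∕k! = ρ⁻¹·A₀·e^{R₁|μ|}·e^{−(κ₁−1)·#S}` (Mathlib's exponential series
`NormedSpace.expSeries_div_hasSum_exp` and `Real.exp_eq_exp_ℝ`) — the term-by-term insertion bounds resum to the window-free letter bound. -/
theorem hasSum_majorant (ρ A₀ κ₁ R₁ : ℝ) (S : Finset (Fin n)) (μ : ℂ) :
    HasSum (fun k : ℕ => ρ⁻¹ * (A₀ * Real.exp (-((κ₁ - 1) * S.card))) * ((R₁ * ‖μ‖) ^ k / k.factorial))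
      (ρ⁻¹ * (A₀ * Real.exp (R₁ * ‖μ‖) * Real.exp (-((κ₁ - 1) * S.card)))) := by
  have h : HasSum (fun k : ℕ => (R₁ * ‖μ‖) ^ k / k.factorial) (Real.exp (R₁ * ‖μ‖)) := by
    rw [Real.exp_eq_exp_ℝ]
    exact NormedSpace.expSeries_div_hasSum_exp (R₁ * ‖μ‖)
  have h2 := h.mul_left (ρ⁻¹ * (A₀ * Real.exp (-((κ₁ - 1) * S.card))))
  have heq : ρ⁻¹ * (A₀ * Real.exp (-((κ₁ - 1) * S.card))) * Real.exp (R₁ * ‖μ‖) =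
      ρ⁻¹ * (A₀ * Real.exp (R₁ * ‖μ‖) * Real.exp (-((κ₁ - 1) * S.card))) := by ring
  rw [heq] at h2
  exact h2

/-! ## §4 Decided check: `E = e^{μ·t·z₀z₁}` — the letter is `μ`, of exponential type `0 ≤ e²` -/

/-- DECIDED CHECK: for `E(μ; t, z₀, z₁) = e^{μ·t·z₀z₁}` (`G = 1`, `Φ₀ = 0`, `O = t·z₀z₁`; `t_□`-radius `1 < 2`, cube radii `3∕2 < 2`) the letter at ANY
source `μ ∈ ℂ` IS `Δ_{01}(∂_t|₀ e^{μ t z₀z₁}) = Δ_{01}(μ·z₀z₁) = μ` — entire, and §2's bound at `κ₁ = 1` (`R₁ = e²` bounds `|t·z₀z₁|` on `{|t| = 1} ×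
{|z_j| ≤ e}`, `A₀ = 1`) reads `|μ| ≤ e^{e²|μ|}`. -/
example (μ : ℂ) : (∫ θ₀ in Icc 0 (2 * Real.pi), w₁ 1 (0, θ₀) *
    ∫ p : Fin 2 → ℝ × ℝ, wS (fun _ => (3 / 2 : ℝ)) {0, 1} p *
      ((1 : ℂ) * cexp (0 + μ * (circ 1 θ₀ * (σS (fun _ => (3 / 2 : ℝ)) {0, 1} p 0 * σS (fun _ => (3 / 2 : ℝ)) {0, 1} p 1))))
        ∂(Measure.pi (μS {0, 1}))) = μ ∧ ‖μ‖ ≤ 1⁻¹ * (1 * Real.exp (Real.exp 1 ^ 2 * ‖μ‖) * Real.exp (-((1 - 1) * (2 : ℕ)))) := by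
  refine ⟨?_, ?_⟩
  · have h2 := tBoxMixedLetter_eq_mixedDiff_deriv_local (n := 2) (ρ := 1) one_pos (r := fun _ => 3 / 2) (R := fun _ => 2) (by norm_num)
      (fun _ => by norm_num) (fun _ => by norm_num) {0, 1}
      (E := fun v => (1 : ℂ) * cexp (0 + μ * (v 0 * (v (Fin.succ 0) * v (Fin.succ 1)))))
      ((analyticOnNhd_const.mul ((analyticOnNhd_const.add (analyticOnNhd_const.mul (analyticOnNhd_tzz _))).cexp)))
    simp only [Fin.cons_zero, Fin.cons_succ] at h2
    rw [h2]
    have hd : ∀ c : ℂ, deriv (fun t : ℂ => (1 : ℂ) * cexp (0 + μ * (t * c))) 0 = μ * c := fun c => by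
      have hb : HasDerivAt (fun t : ℂ => (1 : ℂ) * cexp (0 + μ * (t * c))) (μ * (1 * c) * ((1 : ℂ) * cexp (0 + μ * (0 * c)))) 0 :=
        hasDerivAt_mul_cexp_source (G := 1) ((((hasDerivAt_id (0 : ℂ)).mul_const c).const_mul μ).const_add 0)
      rw [hb.deriv]
      simp
    simp_rw [hd, mixedDiff_pair]
    norm_num
  · have h1 : (1 : ℝ) ≤ Real.exp (Real.exp 1 ^ 2 * ‖μ‖) := Real.one_le_exp (by positivity)
    have h2 : ‖μ‖ ≤ Real.exp (Real.exp 1 ^ 2 * ‖μ‖) := by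
      have h3 : ‖μ‖ ≤ Real.exp 1 ^ 2 * ‖μ‖ := by
        have : (1 : ℝ) ≤ Real.exp 1 ^ 2 := by nlinarith [Real.add_one_le_exp (1 : ℝ)]
        nlinarith [norm_nonneg μ]
      exact h3.trans (by linarith [Real.add_one_le_exp (Real.exp 1 ^ 2 * ‖μ‖)])
    simpa using h2

end Summit.QuantumFields.BalabanUV.T4Continuum.NE1p.DressedSmallFieldTBoxMixedLetterSourceEntire

end
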